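import Mathlib
import HarnessLib
import Summits.HubbardSuperconductivity.HubbardSuperconductivity.Theorems.KLProgrammeKLRegimeEnginePairTransferOutClassFrameShiftSizesGeom

/-!
# Route `KLProgramme` — ENGINE item stmt-HubbardSuperconductivity-20437 `KLRegimeEngineV17F2`, stub (c) value lane: the (c) closer's `hshift` binder
# IN THE CONSUMER'S INDEXING — «(c)-HSHIFT-JOINT» (cell gate-hubbard-kl, seat p2 g25)

The producer of record `hshift_of_sizes_geom` (…FrameShiftSizesGeom, p2 g24) is stated at scale `n` with frames `Kₙ / Kₙ₋₁` and every history / partition-function /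
size row written over `n − 1` (natural subtraction).  The (c)-OUT chain of record CONSUMES the frame shift at the successor index: `outClass_hout_le_bars_klEngGeo14_of_shares`
/ `outClass_hout_klEngGeo14(_split3)_of_shares` (…PairTransferOutClassHoutG14, …HoutG14Split3) and `klvrF_outClass_of_frameShift_sameFrame` take
`hshift : ‖𝒞ₙ₊₁[Kₙ₊₁](Qm;x,y) − 𝒞ₙ₊₁[Kₙ](Qm;x,y)‖ ≤ frameShiftBar P Q U (n+1)` with the frames spelled `klFlowFrameU … (n+1)` / `klFlowFrameU … n`.  Instantiating the
producer at `n + 1` leaves `n + 1 − 1` in six binders and in the conclusion; this file performs that bookkeeping ONCE, so the closer's call is literal: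
* **`hshift_succ_of_sizes_geom`** — `n + 1 ≤ n_β`: history `HistP … 0 (n+1)`, stub binders (`μ ∈ klWindowC`, `klEngL₃ β U ≤ L`), `Z(Kₙ₊₁) ≠ 0` at scale `n+1`, the
  mismatch path `s₀ = uvSymbolCT(Kₙ, Λₙ₊₁)`, `s₁ =` the resummed symbol of `Kₙ₊₁` against `Kₙ`, `Z_t ≠ 0` and the three kernel rows (vertex `V_U + 𝒩_{Kₙ}`), the sizes
  `(a, n₆, s₂, n₄)` and the room line — VERBATIM `hshift_of_sizes_geom` at `n + 1` with `n + 1 − 1 ↦ n`;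
* **`hshift_lastScale_succ_of_size`** — `n_β + 1`: `hshift_of_size_lastScale` with the lower frame spelled `klFlowFrameU … (nScales β)`.
Pure re-indexing (`Nat.add_sub_cancel`); nothing about the sizes is asserted; nothing here asserts (c), any stub of 20437, K3, the margin or superconductivity.
References: BGM 2006 §2.3 (2.21)–(2.24), §3 (3.3) [cite: BenfattoGiulianiMastropietro2006].
-/

noncomputable section

namespace Summit.HubbardSuperconductivity.HubbardSuperconductivity.Theorems.KLRegimeSplit

set_option linter.dupNamespace false -- summit = problem name (single-conjunct summit), D-0017

open Real Finset Literature.MathematicalPhysics.QuantumLattice Literature.Probability.LatticeModels GrassmannAlgebra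
open Summit.HubbardSuperconductivity.HubbardSuperconductivity.Theorems.KLProgrammeLegKernels
open Summit.HubbardSuperconductivity.HubbardSuperconductivity.Theorems.EngineV8
open Summit.HubbardSuperconductivity.HubbardSuperconductivity.Theorems.TwoVolumeDefect
open Summit.HubbardSuperconductivity.HubbardSuperconductivity.Theorems.TwoPointAssembly

section Model

variable {L M : ℕ} [NeZero L] [NeZero M] {G : GeoConsts} {P : SplitConsts} {Q : EngConsts} {R : RenConsts} {β U μ c : ℝ} {n : ℕ}

set_option maxHeartbeats 400000 in -- long binder list; one `rw` over the instantiated producer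
/-- **THE (c) CLOSER'S `hshift` AT THE CONSUMER'S INDEX `n + 1 ≤ n_β`** (`hshift_of_sizes_geom` at `n + 1`, every `n + 1 − 1` spelled `n`): history + stub binders + the two
partition-function facts of the scale-`(n+1)` mismatch path + FOUR sizes `a, n₆, s₂, n₄` + the room line ⇒ `‖𝒞ₙ₊₁[Kₙ₊₁] − 𝒞ₙ₊₁[Kₙ]‖ ≤ frameShiftBar P Q U (n+1)` — the literal
`hshift` binder of `outClass_hout_le_bars_klEngGeo14_of_shares` / `klvrF_outClass_of_frameShift_sameFrame`. [cite: BenfattoGiulianiMastropietro2006, §2.3 (2.21)–(2.24), §3 (3.3)] -/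
theorem hshift_succ_of_sizes_geom (hμ : μ ∈ klWindowC) (hL : klEngL₃ β U ≤ L)
    (hβmin : klBetaMin ≤ β)
    (hnβ : n + 1 ≤ nScales β)
    (hhist : HistP klPredsV17F2 L M G P Q R β U μ 0 (n + 1))
    (hP : P.WF)
    (hRW : R.WF)
    (hQ : (klEngQ8 P R).IsRaiseOf Q)
    (hU : 0 < U)
    (hU4 : U ≤ klEngU₀4 P R c)
    (hβ : 0 < β)
    {Qm x y : TorusSite 2 L}
    (hZ₂ : effPartitionFn ℂ (normalCovariance L M (uvSymbolCT L M β μ (klFlowFrameU L M β U μ (n + 1)) (klScale klE0 (n + 1))))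
      (hubbardInteraction L M β U + counterQuadratic L M β (klFlowFrameU L M β U μ (n + 1))) ≠ 0)
    {s₀ s₁ : FreqMomentum L M × Fin 2 → ℂ}
    (hs₀ : s₀ = uvSymbolCT L M β μ (klFlowFrameU L M β U μ n) (klScale klE0 (n + 1)))
    (hs₁ : s₁ = fun ks => uvSymbolCT L M β μ (klFlowFrameU L M β U μ (n + 1)) (klScale klE0 (n + 1)) ks /
      (1 + uvSymbolCT L M β μ (klFlowFrameU L M β U μ (n + 1)) (klScale klE0 (n + 1)) ks *
        (((fsub (klFlowFrameU L M β U μ (n + 1)) (klFlowFrameU L M β U μ n)).eval (latticeMomentum L ks.1.2) / (β * (L : ℝ) ^ 2) : ℝ) : ℂ)))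
    (hZ : ∀ t ∈ Set.Icc (0 : ℝ) 1, effPartitionFn ℂ (normalCovariance L M s₀ + ((t : ℂ)) • (normalCovariance L M s₁ - normalCovariance L M s₀))
      (hubbardInteraction L M β U + counterQuadratic L M β (klFlowFrameU L M β U μ n)) ≠ 0)
    {a n₆ s₂ n₄ : ℝ}
    (ha0 : 0 ≤ a)
    (ha : a ≤ 2 ^ 28)
    (hn₆ : 0 ≤ n₆)
    (hs₂ : 0 ≤ s₂)
    (hn₄ : 0 ≤ n₄)
    (hroom : 547400 * (8 / Real.pi * 2946 * n₆ + 4 * s₂ * n₄) ≤ klHshiftC)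
    (hC4 : ‖klPairAmplitude L M β U μ (klFlowFrameU L M β U μ (n + 1)) (n + 1) Qm x y‖ ≤ a * (P.Klam * |U|))
    (hN6 : ∀ t ∈ Set.Icc (0 : ℝ) 1, ∀ A : HubbardFieldIdx L M,
      ‖kernel ℂ (effAction ℂ (normalCovariance L M s₀ + ((t : ℂ)) • (normalCovariance L M s₁ - normalCovariance L M s₀))
        (hubbardInteraction L M β U + counterQuadratic L M β (klFlowFrameU L M β U μ n))) 6
        (Fin.snoc (Fin.snoc ![(((omega0 M, y), 0), 0), ((((omega0 M).rev, Qm - y), 1), 0), ((((omega0 M).rev, Qm - x), 1), 1), (((omega0 M, x), 0), 1)] (A.1, 1 - A.2) : Fin 5 → HubbardFieldIdx L M) A)‖ ≤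
          n₆ * (P.Klam * U) ^ 2 / klScale klE0 (n + 1) / (720 * (β * (L : ℝ) ^ 2) ^ 5))
    (hS : ∀ t ∈ Set.Icc (0 : ℝ) 1, ∀ i : Fin 4,
      |nambuXiCT L μ (klFlowFrameU L M β U μ n) ((![(((omega0 M, y), 0), 0), ((((omega0 M).rev, Qm - y), 1), 0), ((((omega0 M).rev, Qm - x), 1), 1), (((omega0 M, x), 0), 1)] :
              Fin 4 → HubbardFieldIdx L M) i).1.1.2| < 5 * klScale klE0 (n + 1) / 4 →
      ‖kernel ℂ (effAction ℂ (normalCovariance L M s₀ + ((t : ℂ)) • (normalCovariance L M s₁ - normalCovariance L M s₀))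
        (hubbardInteraction L M β U + counterQuadratic L M β (klFlowFrameU L M β U μ n))) 2
        ![((((![(((omega0 M, y), 0), 0), ((((omega0 M).rev, Qm - y), 1), 0), ((((omega0 M).rev, Qm - x), 1), 1), (((omega0 M, x), 0), 1)] :
              Fin 4 → HubbardFieldIdx L M) i).1,
            1 - ((![(((omega0 M, y), 0), 0), ((((omega0 M).rev, Qm - y), 1), 0), ((((omega0 M).rev, Qm - x), 1), 1), (((omega0 M, x), 0), 1)] :
              Fin 4 → HubbardFieldIdx L M) i).2) : HubbardFieldIdx L M),
          (![(((omega0 M, y), 0), 0), ((((omega0 M).rev, Qm - y), 1), 0), ((((omega0 M).rev, Qm - x), 1), 1), (((omega0 M, x), 0), 1)] :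
              Fin 4 → HubbardFieldIdx L M) i]‖ ≤ s₂ * |U| * klScale klE0 (n + 1) / (2 * (β * (L : ℝ) ^ 2)))
    (hN4 : ∀ t ∈ Set.Icc (0 : ℝ) 1,
      ‖kernel ℂ (effAction ℂ (normalCovariance L M s₀ + ((t : ℂ)) • (normalCovariance L M s₁ - normalCovariance L M s₀))
        (hubbardInteraction L M β U + counterQuadratic L M β (klFlowFrameU L M β U μ n))) 4
        ![(((omega0 M, y), 0), 0), ((((omega0 M).rev, Qm - y), 1), 0), ((((omega0 M).rev, Qm - x), 1), 1), (((omega0 M, x), 0), 1)]‖ ≤ n₄ * (P.Klam * |U|) / (24 * (β * (L : ℝ) ^ 2) ^ 3)) :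
    ‖klPairAmplitude L M β U μ (klFlowFrameU L M β U μ (n + 1)) (n + 1) Qm x y - klPairAmplitude L M β U μ (klFlowFrameU L M β U μ n) (n + 1) Qm x y‖ ≤
      frameShiftBar P Q U (n + 1) := by
  have key := @hshift_of_sizes_geom L M _ _ G P Q R β U μ c (n + 1) hμ hL hβmin hnβ hhist (Nat.le_add_left 1 n) hP hRW hQ hU hU4 hβ Qm x y hZ₂ s₀ s₁
  rw [Nat.add_sub_cancel] at key
  exact key hs₀ hs₁ hZ ha0 ha hn₆ hs₂ hn₄ hroom hC4 hN6 hS hN4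

/-- **THE (c) CLOSER'S `hshift` AT THE LAST INDEX `n_β + 1`** (`hshift_of_size_lastScale` with the lower frame spelled `klFlowFrameU … (nScales β)`): history + stub rows +
`IsUnit Z(K_{n_β+1})` + ONE size `a ≤ 2²⁸` ⇒ `‖𝒞_{n_β+1}[K_{n_β+1}] − 𝒞_{n_β+1}[K_{n_β}]‖ ≤ frameShiftBar P Q U (n_β+1)`. [cite: BenfattoGiulianiMastropietro2006, §2.3 (2.24)] -/
theorem hshift_lastScale_succ_of_size (hhist : HistP klPredsV17F2 L M G P Q R β U μ 0 (nScales β + 1)) (hP : P.WF) (hRW : R.WF)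
    (hQ : (klEngQ8 P R).IsRaiseOf Q) (hU : 0 < U) (hU4 : U ≤ klEngU₀4 P R c) (hβ : 0 < β) {Qm x y : TorusSite 2 L}
    (hZ₂ : IsUnit (effPartitionFn ℂ (normalCovariance L M (uvSymbolCT L M β μ (klFlowFrameU L M β U μ (nScales β + 1)) (klScale klE0 (nScales β + 1))))
      (hubbardInteraction L M β U + counterQuadratic L M β (klFlowFrameU L M β U μ (nScales β + 1)))))
    {a : ℝ} (ha0 : 0 ≤ a) (ha : a ≤ 2 ^ 28)
    (hC4 : ‖klPairAmplitude L M β U μ (klFlowFrameU L M β U μ (nScales β + 1)) (nScales β + 1) Qm x y‖ ≤ a * (P.Klam * |U|)) :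
    ‖klPairAmplitude L M β U μ (klFlowFrameU L M β U μ (nScales β + 1)) (nScales β + 1) Qm x y -
        klPairAmplitude L M β U μ (klFlowFrameU L M β U μ (nScales β)) (nScales β + 1) Qm x y‖ ≤ frameShiftBar P Q U (nScales β + 1) := by
  have key := hshift_of_size_lastScale hhist hP hRW hQ hU hU4 hβ hZ₂ ha0 ha hC4
  rwa [Nat.add_sub_cancel] at key

end Model

end Summit.HubbardSuperconductivity.HubbardSuperconductivity.Theorems.KLRegimeSplit

end
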